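import Summits.Ventures.HSemireg.WedgeHankelRecurrenceCompleteIntersectionTop
import Summits.Ventures.HSemireg.WedgeHankelRecurrenceCompleteIntersectionDegrees

/-!
# Venture HSemireg — THE GENERATOR PAIR FROM AN EVEN LEVEL AT TOP RANK TO THE NEXT LEVEL (the Euclid ∕ Berlekamp–Massey step at the top; completes N74): for `R^{2t}(q) = t + 1` with N59's
# independent pair `g₁` (`deg ≤ t`, `≠ 0`), `g₂` (`deg = t + 1`) spanning `Rec^{2t}_{t+1}(q)` and the discrepancies `δᵢ := ⟪gᵢ, q⟫_t` at the new coefficient `q_{2t+1}`: **`δ₁ ≠ 0` always, the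
# minimal recurrence at level `2t + 1` is `m′ = δ₂·g₁ − δ₁·g₂` (degree `t + 1`, the class is affine of rank `t + 1`), and `(m′, g₁)` is a coprime generator pair with windows `(t + 1, t + 2)`**

HONEST FRAMING. Part of the Lean index of the computation cell `pub-hsemireg` (seat p10 gen 30, Sunday typer «UNIFORM-IN-n»).
LINEAR ALGEBRA OF HANKEL (catalecticant) MATRICES and of polynomials over a field ONLY: no variety, no cohomology theory, no sheaf, no Ext group and no semiregularity map is constructed
here; nothing here says that HC / HC_CM / HC_AV holds; no Literature fact is declared or used.  Custodian versions as in `WedgeHankelSiegelIdeal` (1/3); the dictionary («discrepancy»,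
Berlekamp–Massey; with N74 the generator pair `(m, g)` of N56 ∕ N59 now propagates through EVERY level `N → N + 1`: inside the window by N74, from the top of an even level by this file —
the Euclidean algorithm on the symbol, level by level) is QUOTED in docstrings, never asserted.

WHAT IS IN THE TREE.  N59 (`WedgeHankelRecurrenceCompleteIntersectionTop`, № 386): `exists_basis_recSpace_top`, `isCoprime_of_not_mem_top`, `recSpace_top_eq_sup_of_not_mem`; N58 (№ 384)
`not_mem_map_mulRight_degreeLT_of_natDegree_lt`; N43 (№ 323) `isAffineClass_level_succ_of_top`, `exists_smul_eq_of_mem_recSpace_self`; N42 (№ 313) `rank_half_level_succ_of_top`,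
`natDegree_eq_of_mem_recSpace_top` (every non-zero member of `Rec^{2t+1}_{t+1}` has degree `t + 1`); N41 (№ 299) `mem_recSpace_succ_iff_hkFun_eq_zero` (the discrepancy); N29 (№ 237)
`mem_recSpace_succ_succ_iff`; N18 (№ 173) `recSpace_le_degreeLT`, `natDegree_le_of_mem_recSpace`.  Mathlib: `IsCoprime.add_mul_left_right_iff`, `isCoprime_mul_unit_left_right`, `Polynomial.smul_eq_C_mul`.
THIS FILE (namespace `Summit.Ventures.HSemireg.Wedge.HankelOuter` continued; PLAIN on N59 + N58; 0 definitions).  Levels written `2 * t` (N42/N43) — N59's `t + t` via `two_mul`.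
* §634 `mem_recSpace_top_level_succ_iff` (`p ∈ Rec^{2t}_{t+1}(q)`: `p ∈ Rec^{2t+1}_{t+1}(q) ↔ ⟪p, q⟫_t = 0`), **`hkFun_ne_zero_of_natDegree_le_top`** (`δ₁ ≠ 0`: a member of degree `≤ t` NEVER continues),
  **`smul_sub_smul_mem_recSpace_top_level_succ`** (`m′ := δ₂·g₁ − δ₁·g₂ ∈ Rec^{2t+1}_{t+1}(q)`), `smul_sub_smul_ne_zero_top` (`m′ ≠ 0`), `natDegree_smul_sub_smul_top` (`deg m′ = t + 1`),
  `exists_smul_eq_smul_sub_smul_top` (`m′` SPANS the new minimal window), `isCoprime_smul_sub_smul_top` (`IsCoprime m′ g₁`),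
  **`generatorPair_top_level_succ`** (THE STEP: rank `t + 1` affine, minimal `m′`, second generator `g₁ ∈ Rec^{2t+1}_{t+2}(q) ∖ m′·K[X]_{≤ 1}`, coprime — N56's hypotheses at level `2t + 1`).
Nothing Ext-side.  New names only.
-/

open Module Polynomial
open scoped Matrix Polynomial

namespace Summit.Ventures.HSemireg.Wedge.HankelOuter

open Summit.Ventures.HSemireg.Wedge Summit.Ventures.HSemireg.Wedge.Hankel

variable (K : Type*) [Field K]

/-! ## §634. From the top of an even level -/

/-- for `p ∈ Rec^{2t}_{t+1}(q)`: **`p ∈ Rec^{2t+1}_{t+1}(q) ↔ ⟪p, q⟫_t = 0`** (the discrepancy at the new coefficient, N41). -/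
theorem mem_recSpace_top_level_succ_iff {t : ℕ} {q : ℕ → K} {p : K[X]} (hp : p ∈ recSpace K (2 * t) q (t + 1)) : p ∈ recSpace K (2 * t + 1) q (t + 1) ↔ hkFun K q t p = 0 := by
  rw [mem_recSpace_succ_iff_hkFun_eq_zero K (by omega) hp, show 2 * t + 1 - (t + 1) = t by omega]

section TopStep

variable {K}
variable {t : ℕ} {q : ℕ → K} {g₁ g₂ : K[X]}

/-- **`δ₁ ≠ 0`: A RECURRENCE OF DEGREE `≤ t` IN THE TOP WINDOW NEVER CONTINUES** — at level `2t + 1` every non-zero member of the minimal window has degree `t + 1` (N42). -/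
theorem hkFun_ne_zero_of_natDegree_le_top (hq : (hankel1 K (2 * t) (2 * t / 2) q).rank = t + 1) (hg₁ : g₁ ∈ recSpace K (2 * t) q (t + 1)) (hg₁0 : g₁ ≠ 0) (hg₁d : g₁.natDegree ≤ t) :
    hkFun K q t g₁ ≠ 0 := by
  intro h
  have hmem : g₁ ∈ recSpace K (2 * t + 1) q (t + 1) := (mem_recSpace_top_level_succ_iff K hg₁).mpr h
  have := natDegree_eq_of_mem_recSpace_top K hq hmem hg₁0
  omega

/-- **THE NEW MINIMAL RECURRENCE: `δ₂·g₁ − δ₁·g₂ ∈ Rec^{2t+1}_{t+1}(q)`** for any `g₁, g₂ ∈ Rec^{2t}_{t+1}(q)` (`δᵢ = ⟪gᵢ, q⟫_t`; its discrepancy is `δ₂δ₁ − δ₁δ₂ = 0`). -/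
theorem smul_sub_smul_mem_recSpace_top_level_succ (hg₁ : g₁ ∈ recSpace K (2 * t) q (t + 1)) (hg₂ : g₂ ∈ recSpace K (2 * t) q (t + 1)) :
    hkFun K q t g₂ • g₁ - hkFun K q t g₁ • g₂ ∈ recSpace K (2 * t + 1) q (t + 1) := by
  refine (mem_recSpace_top_level_succ_iff K (Submodule.sub_mem _ (Submodule.smul_mem _ _ hg₁) (Submodule.smul_mem _ _ hg₂))).mpr ?_
  rw [map_sub, map_smul, map_smul, smul_eq_mul, smul_eq_mul, mul_comm, sub_self]

variable (hq : (hankel1 K (2 * t) (2 * t / 2) q).rank = t + 1) (hg₁ : g₁ ∈ recSpace K (2 * t) q (t + 1)) (hg₁0 : g₁ ≠ 0) (hg₁d : g₁.natDegree ≤ t)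
  (hg₂ : g₂ ∈ recSpace K (2 * t) q (t + 1)) (hg₂A : g₂ ∉ (Polynomial.degreeLT K (0 + 1)).map (LinearMap.mulRight K g₁))
include hq hg₁ hg₁0 hg₁d hg₂ hg₂A

omit hg₂ in
/-- `δ₂·g₁ − δ₁·g₂ ≠ 0` (the pair is independent and `δ₁ ≠ 0`). -/
theorem smul_sub_smul_ne_zero_top : hkFun K q t g₂ • g₁ - hkFun K q t g₁ • g₂ ≠ 0 := by
  intro h
  have hδ₁ := hkFun_ne_zero_of_natDegree_le_top hq hg₁ hg₁0 hg₁d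
  apply hg₂A
  refine ⟨Polynomial.C ((hkFun K q t g₁)⁻¹ * hkFun K q t g₂), (mem_degreeLT_succ_iff K).mpr (by rw [Polynomial.natDegree_C]), ?_⟩
  rw [LinearMap.mulRight_apply, ← Polynomial.smul_eq_C_mul, mul_smul]
  rw [sub_eq_zero] at h
  rw [h, ← mul_smul, inv_mul_cancel₀ hδ₁, one_smul]

/-- **`deg (δ₂·g₁ − δ₁·g₂) = t + 1`.** -/
theorem natDegree_smul_sub_smul_top : (hkFun K q t g₂ • g₁ - hkFun K q t g₁ • g₂).natDegree = t + 1 :=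
  natDegree_eq_of_mem_recSpace_top K hq (smul_sub_smul_mem_recSpace_top_level_succ hg₁ hg₂) (smul_sub_smul_ne_zero_top hq hg₁ hg₁0 hg₁d hg₂A)

/-- **`δ₂·g₁ − δ₁·g₂` SPANS the minimal window `Rec^{2t+1}_{t+1}(q)`**: every member is a scalar multiple of it. -/
theorem exists_smul_eq_smul_sub_smul_top {p : K[X]} (hp : p ∈ recSpace K (2 * t + 1) q (t + 1)) : ∃ c : K, p = c • (hkFun K q t g₂ • g₁ - hkFun K q t g₁ • g₂) :=
  exists_smul_eq_of_mem_recSpace_self K (rank_half_level_succ_of_top K hq) (by omega) (smul_sub_smul_mem_recSpace_top_level_succ hg₁ hg₂)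
    (smul_sub_smul_ne_zero_top hq hg₁ hg₁0 hg₁d hg₂A) hp

/-- `gcd(δ₂ g₁ − δ₁ g₂, g₁) = 1` (from `gcd(g₁, g₂) = 1`, N59, and `δ₁ ≠ 0`). -/
theorem isCoprime_smul_sub_smul_top : IsCoprime (hkFun K q t g₂ • g₁ - hkFun K q t g₁ • g₂) g₁ := by
  have hq' : (hankel1 K (t + t) ((t + t) / 2) q).rank = t + 1 := by rw [← two_mul]; exact hq
  have hcop : IsCoprime g₁ g₂ := isCoprime_of_not_mem_top K hq' (by rw [← two_mul]; exact hg₁) hg₁0 (by rw [← two_mul]; exact hg₂) hg₂A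
  have hδ₁ := hkFun_ne_zero_of_natDegree_le_top hq hg₁ hg₁0 hg₁d
  have h1 : IsCoprime g₁ (hkFun K q t g₂ • g₁ - hkFun K q t g₁ • g₂) := by
    rw [Polynomial.smul_eq_C_mul, Polynomial.smul_eq_C_mul, sub_eq_neg_add, ← neg_mul, mul_comm (Polynomial.C (hkFun K q t g₂)) g₁, IsCoprime.add_mul_left_right_iff,
      isCoprime_mul_unit_left_right ((Polynomial.isUnit_C.mpr (isUnit_iff_ne_zero.mpr hδ₁)).neg)]
    exact hcop
  exact h1.symm

/-- **THE STEP FROM THE TOP: at level `2t + 1` the class is AFFINE of rank `t + 1` with minimal recurrence `m′ = δ₂·g₁ − δ₁·g₂` (degree `t + 1`), and `(m′, g₁)` IS A COPRIME GENERATOR PAIR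
with windows `(t + 1, t + 2)`: `g₁ ∈ Rec^{2t+1}_{t+2}(q) ∖ m′·K[X]_{≤ 1}`** — exactly N56's hypotheses at level `N = 2t + 1`, `r = t + 1` (`N + 2 − r = t + 2`, `N + 2 − r − r + 1 = 2`). -/
theorem generatorPair_top_level_succ :
    IsAffineClass K (2 * t + 1) (t + 1) q ∧ (hankel1 K (2 * t + 1) ((2 * t + 1) / 2) q).rank = t + 1 ∧
      hkFun K q t g₂ • g₁ - hkFun K q t g₁ • g₂ ∈ recSpace K (2 * t + 1) q (t + 1) ∧ (hkFun K q t g₂ • g₁ - hkFun K q t g₁ • g₂).natDegree = t + 1 ∧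
      g₁ ∈ recSpace K (2 * t + 1) q (2 * t + 1 + 2 - (t + 1)) ∧
      g₁ ∉ (Polynomial.degreeLT K (2 * t + 1 + 2 - (t + 1) - (t + 1) + 1)).map (LinearMap.mulRight K (hkFun K q t g₂ • g₁ - hkFun K q t g₁ • g₂)) ∧
      IsCoprime (hkFun K q t g₂ • g₁ - hkFun K q t g₁ • g₂) g₁ := by
  have hdeg := natDegree_smul_sub_smul_top hq hg₁ hg₁0 hg₁d hg₂ hg₂A
  refine ⟨isAffineClass_level_succ_of_top K hq, rank_half_level_succ_of_top K hq, smul_sub_smul_mem_recSpace_top_level_succ hg₁ hg₂, hdeg, ?_, ?_,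
    isCoprime_smul_sub_smul_top hq hg₁ hg₁0 hg₁d hg₂ hg₂A⟩
  · rw [show 2 * t + 1 + 2 - (t + 1) = t + 1 + 1 by omega]
    exact (mem_recSpace_succ_succ_iff K (recSpace_le_degreeLT K q _ hg₁)).mpr hg₁
  · exact not_mem_map_mulRight_degreeLT_of_natDegree_lt K hg₁0 (by rw [hdeg]; omega) _

end TopStep

end Summit.Ventures.HSemireg.Wedge.HankelOuter
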